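import Summits.CriticalPhenomena.Ising3DConformalLimit.Theses.EnergyNotSigmaSquared
import Literature.Probability.LatticeModels.SourcedDoubleCurrentsSwitchingProofs
import Literature.Probability.LatticeModels.CriticalTwoPointLower
import Literature.Probability.Percolation.LocalLimitConnections
import Summits.CriticalPhenomena.Ising3DConformalLimit.Theorems.PerfectScreeningScreeningDichotomyGreen

/-!
# Localisation of the parallel adjacent avoidance: the heart of `EnergyGapPowerLaw` in finite volume
(item stmt-CriticalPhenomena-4469, route `EnergyNotSigmaSquared`, sub-problem `Ising3DConformalLimit`;
helper file `--supports stmt-CriticalPhenomena-4469`, line `registered` of the crux)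

Notation: `β_c = criticalBeta 3`, `e₂ = Pi.single 1 1`, `A = {0} ∆ {x}`, `B = {e₂} ∆ {x + e₂}`,
`P_L = sourcedDoubleCurrentLaw 3 L β_c A B` (the FINITE-VOLUME law, free box `Λ_L`, of the trace
`n̂₁ ∪ n̂₂` of two independent currents with sources `∂n₁ = A`, `∂n₂ = B` — a push-forward of the tree's
`doubleCurrentMeasure (freeBoxGraph 3 L) …`), `P = sourcedDoubleCurrentLawInf 3 β_c A B` (its weak limit
on local events), `S_N = {0 ↔ e₂ inside Λ_N} = openConnVia (withinGraph ⊤ ↑(box 3 N)) 0 e₂` (a LOCAL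
event), `A_par(x) = 1 − P[0 ↔ e₂]`.

By `Theorems/EnergyNotSigmaSquaredEnergyGapPowerLawOnePairing.lean` the crux GAP is EQUIVALENT to the
power decay of the infinite-volume parallel avoidance `A_par(x) ≤ C‖x‖^{-κ}`.  This file moves that
statement to FINITE volume, so that a proof of the heart never has to touch an infinite-volume current:

* `parAvoidance_le_of_eventually_le` — **localisation**: if `1 − P_L[S_N] ≤ τ` for all large `L` (some
  fixed `N`), then `A_par(x) ≤ τ` (`S_N ⊆ {0 ↔ e₂}` and `P_L[S_N] → P[S_N]`, the defining weak limit,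
  which exists by `exists_isSourcedDoubleCurrentLimit` since `β_c(3) > 0` and `#A`, `#B` are even);
* `parAvoidancePowerLaw_of_local` — hence the finite-volume statement
  `∃ κ > 0, C, ∀ x ≠ 0, ∃ N, ∀ᶠ L, 1 − P_L[0 ↔ e₂ inside Λ_N] ≤ C‖x‖^{-κ}` (registered stub
  `stub_localParAvoidancePowerLaw` of the skeleton) implies `ParAvoidancePowerLaw`, hence the crux;
* `local_of_parAvoidancePowerLaw` — and conversely (`{0 ↔ e₂} = ⋃_N S_N` increasing, continuity from
  below, then the weak limit), so NOTHING IS LOST: the finite-volume statement is equivalent to the crux;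
* `stub_localisation` — the registered glue stub of the skeleton, by name.

## References

* M. Aizenman, H. Duminil-Copin, V. Sidoravicius, Comm. Math. Phys. 334 (2015), proof of Thm. 3.1
  (passage to the limit on box-constrained connections) [AizenmanDuminilCopinSidoraviciusCMP2015].
* M. Aizenman, H. Duminil-Copin, Ann. of Math. 194 (2021), §3.2 [AizenmanDuminilCopinAnnals2021].
-/

noncomputable section

namespace Summit.CriticalPhenomena.Ising3DConformalLimit.EnergyNotSigmaSquaredEnergyGapPowerLaw

open scoped symmDiff
open MeasureTheory Filter Topology
open Literature.Probability.LatticeModels Literature.Probability.Percolation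
open Summit.CriticalPhenomena.Ising3DConformalLimit.Theorems.PerfectScreening (one_le_norm_of_ne_zero)

/-- The infinite-volume sourced double current `P^{{0}∆{x},{e₂}∆{x+e₂}}_{β_c}` exists (`β_c(3) > 0` by
`criticalBeta_pos_holds`; both source sets have even cardinality). [cite: AizenmanDuminilCopinAnnals2021, §3.2] -/
theorem exists_isSourcedDoubleCurrentLimit_par (x : Site 3) :
    ∃ μ, IsSourcedDoubleCurrentLimit 3 (criticalBeta 3) ({0} ∆ {x})
      ({(Pi.single 1 1 : Site 3)} ∆ {x + Pi.single 1 1}) μ :=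
  exists_isSourcedDoubleCurrentLimit 3 (criticalBeta_pos_holds (d := 3) (by norm_num))
    (even_card_singleton_symmDiff _ _) (even_card_singleton_symmDiff _ _)

/-- **Localisation.**  If, for some fixed local box `Λ_N`, the finite-volume local avoidance satisfies
`1 − P_L[0 ↔ e₂ inside Λ_N] ≤ τ` for all large `L`, then the infinite-volume parallel avoidance obeys
`A_par(x) = 1 − P[0 ↔ e₂] ≤ τ` (`{0 ↔ e₂ inside Λ_N}` is a local event contained in `{0 ↔ e₂}`, and
`P_L → P` on local events). [cite: AizenmanDuminilCopinSidoraviciusCMP2015, proof of Thm. 3.1] -/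
theorem parAvoidance_le_of_eventually_le (x : Site 3) (N : ℕ) {τ : ℝ}
    (h : ∀ᶠ L : ℕ in atTop,
      1 - (sourcedDoubleCurrentLaw 3 L (criticalBeta 3) ({0} ∆ {x})
            ({(Pi.single 1 1 : Site 3)} ∆ {x + Pi.single 1 1})).real
          (openConnVia (withinGraph ⊤ (↑(box 3 N) : Set (Site 3))) 0 (Pi.single 1 1)) ≤ τ) :
    1 - (sourcedDoubleCurrentLawInf 3 (criticalBeta 3) ({0} ∆ {x})
          ({(Pi.single 1 1 : Site 3)} ∆ {x + Pi.single 1 1})).real (openConn 0 (Pi.single 1 1)) ≤ τ := by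
  set S : Set (BondConfig (Site 3)) :=
    openConnVia (withinGraph ⊤ (↑(box 3 N) : Set (Site 3))) 0 (Pi.single 1 1) with hS
  have hex := exists_isSourcedDoubleCurrentLimit_par x
  haveI := (isSourcedDoubleCurrentLimit_lawInf hex).isProbabilityMeasure
  have hlim := tendsto_sourcedDoubleCurrentLaw_real hex
    (isLocalEvent_openConnVia_withinGraph_box N (0 : Site 3) (Pi.single 1 1))
  -- pass to the limit on the local event
  have h1 : 1 - (sourcedDoubleCurrentLawInf 3 (criticalBeta 3) ({0} ∆ {x})
      ({(Pi.single 1 1 : Site 3)} ∆ {x + Pi.single 1 1})).real S ≤ τ :=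
    le_of_tendsto (hlim.const_sub 1) h
  -- `{0 ↔ e₂ inside Λ_N} ⊆ {0 ↔ e₂}`
  have hsub : S ⊆ openConn 0 (Pi.single 1 1) := fun ω hω =>
    openClusterIn_subset_openCluster _ ω 0 hω
  have hmono : (sourcedDoubleCurrentLawInf 3 (criticalBeta 3) ({0} ∆ {x})
      ({(Pi.single 1 1 : Site 3)} ∆ {x + Pi.single 1 1})).real S ≤
      (sourcedDoubleCurrentLawInf 3 (criticalBeta 3) ({0} ∆ {x})
        ({(Pi.single 1 1 : Site 3)} ∆ {x + Pi.single 1 1})).real (openConn 0 (Pi.single 1 1)) :=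
    measureReal_mono hsub
  linarith

/-- **The finite-volume heart implies `ParAvoidancePowerLaw`.**  If for some `κ > 0`, `C`, every
`x ≠ 0` admits a local box `Λ_N` with `1 − P_L[0 ↔ e₂ inside Λ_N] ≤ C‖x‖^{-κ}` for all large `L`,
then `A_par(x) ≤ C‖x‖^{-κ}` for all `x ≠ 0`. [cite: AizenmanDuminilCopinSidoraviciusCMP2015, proof of Thm. 3.1] -/
theorem parAvoidancePowerLaw_of_local
    (hloc : ∃ κ C : ℝ, 0 < κ ∧ ∀ x : Site 3, x ≠ 0 → ∃ N : ℕ, ∀ᶠ L : ℕ in atTop,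
      1 - (sourcedDoubleCurrentLaw 3 L (criticalBeta 3) ({0} ∆ {x})
            ({(Pi.single 1 1 : Site 3)} ∆ {x + Pi.single 1 1})).real
          (openConnVia (withinGraph ⊤ (↑(box 3 N) : Set (Site 3))) 0 (Pi.single 1 1)) ≤
        C * (‖x‖ : ℝ) ^ (-κ)) :
    ∃ κ C : ℝ, 0 < κ ∧ ∀ x : Site 3, x ≠ 0 →
      1 - (sourcedDoubleCurrentLawInf 3 (criticalBeta 3) ({0} ∆ {x})
            ({(Pi.single 1 1 : Site 3)} ∆ {x + Pi.single 1 1})).real (openConn 0 (Pi.single 1 1)) ≤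
        C * (‖x‖ : ℝ) ^ (-κ) := by
  obtain ⟨κ, C, hκ, h⟩ := hloc
  refine ⟨κ, C, hκ, fun x hx => ?_⟩
  obtain ⟨N, hN⟩ := h x hx
  exact parAvoidance_le_of_eventually_le x N hN

/-- **Nothing is lost: `ParAvoidancePowerLaw` implies the finite-volume statement** (with the constant
`max C 0 + 1`): `{0 ↔ e₂} = ⋃_N {0 ↔ e₂ inside Λ_N}` is an increasing union, so `P[S_N] ↑ P[0 ↔ e₂]`
(continuity from below) and then `P_L[S_N] → P[S_N]`; the slack `‖x‖^{-κ} > 0` absorbs both limits.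
[cite: AizenmanDuminilCopinSidoraviciusCMP2015, proof of Thm. 3.1] -/
theorem local_of_parAvoidancePowerLaw
    (hpar : ∃ κ C : ℝ, 0 < κ ∧ ∀ x : Site 3, x ≠ 0 →
      1 - (sourcedDoubleCurrentLawInf 3 (criticalBeta 3) ({0} ∆ {x})
            ({(Pi.single 1 1 : Site 3)} ∆ {x + Pi.single 1 1})).real (openConn 0 (Pi.single 1 1)) ≤
        C * (‖x‖ : ℝ) ^ (-κ)) :
    ∃ κ C : ℝ, 0 < κ ∧ ∀ x : Site 3, x ≠ 0 → ∃ N : ℕ, ∀ᶠ L : ℕ in atTop,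
      1 - (sourcedDoubleCurrentLaw 3 L (criticalBeta 3) ({0} ∆ {x})
            ({(Pi.single 1 1 : Site 3)} ∆ {x + Pi.single 1 1})).real
          (openConnVia (withinGraph ⊤ (↑(box 3 N) : Set (Site 3))) 0 (Pi.single 1 1)) ≤
        C * (‖x‖ : ℝ) ^ (-κ) := by
  obtain ⟨κ, C, hκ, h⟩ := hpar
  refine ⟨κ, max C 0 + 1, hκ, fun x hx => ?_⟩
  have hx1 : 1 ≤ ‖x‖ := one_le_norm_of_ne_zero hx
  have hxpos : 0 < ‖x‖ := lt_of_lt_of_le one_pos hx1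
  set ρ : ℝ := (‖x‖ : ℝ) ^ (-κ) with hρ
  have hρpos : 0 < ρ := Real.rpow_pos_of_pos hxpos _
  set μ := sourcedDoubleCurrentLawInf 3 (criticalBeta 3) ({0} ∆ {x})
    ({(Pi.single 1 1 : Site 3)} ∆ {x + Pi.single 1 1}) with hμ
  set S : ℕ → Set (BondConfig (Site 3)) := fun N =>
    openConnVia (withinGraph ⊤ (↑(box 3 N) : Set (Site 3))) 0 (Pi.single 1 1) with hS
  have hex := exists_isSourcedDoubleCurrentLimit_par x
  haveI := (isSourcedDoubleCurrentLimit_lawInf hex).isProbabilityMeasure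
  have hA := h x hx
  have hCρ : C * ρ ≤ max C 0 * ρ := mul_le_mul_of_nonneg_right (le_max_left _ _) hρpos.le
  -- continuity from below: `μ (S N) → μ {0 ↔ e₂}`
  have hunion : (openConn 0 (Pi.single 1 1) : Set (BondConfig (Site 3))) = ⋃ N, S N :=
    openConn_eq_iUnion_openConnVia_box 0 (Pi.single 1 1)
  have hmonoS : Monotone S := monotone_openConnVia_withinGraph_box 0 (Pi.single 1 1)
  have hup : Tendsto (fun N => μ.real (S N)) atTop (𝓝 (μ.real (openConn 0 (Pi.single 1 1)))) := by
    rw [hunion]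
    have h1 : Tendsto (fun N => μ (S N)) atTop (𝓝 (μ (⋃ N, S N))) := tendsto_measure_iUnion_atTop hmonoS
    exact (ENNReal.tendsto_toReal (measure_ne_top _ _)).comp h1
  -- choose `N` with `μ (S N) ≥ μ {0 ↔ e₂} - ρ/2`
  have hevN : ∀ᶠ N in atTop, μ.real (openConn 0 (Pi.single 1 1)) - ρ / 2 < μ.real (S N) :=
    hup.eventually (lt_mem_nhds (by linarith))
  obtain ⟨N, hN⟩ := hevN.exists
  refine ⟨N, ?_⟩
  -- then `P_L (S N) → μ (S N)`
  have hlim := tendsto_sourcedDoubleCurrentLaw_real hex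
    (isLocalEvent_openConnVia_withinGraph_box N (0 : Site 3) (Pi.single 1 1))
  have hevL : ∀ᶠ L : ℕ in atTop, μ.real (S N) - ρ / 2 <
      (sourcedDoubleCurrentLaw 3 L (criticalBeta 3) ({0} ∆ {x})
        ({(Pi.single 1 1 : Site 3)} ∆ {x + Pi.single 1 1})).real (S N) :=
    hlim.eventually (lt_mem_nhds (by linarith))
  filter_upwards [hevL] with L hL
  have : 1 - μ.real (openConn 0 (Pi.single 1 1)) ≤ C * ρ := hA
  nlinarith [hL, hN, this, hCρ, hρpos]

/-- **Registered stub `stub_localisation` of the crux skeleton (line `registered`,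
`Cruxes/EnergyGapPowerLaw/Lines/birth.lean`)**: the finite-volume heart implies the infinite-volume
parallel avoidance power law — `parAvoidancePowerLaw_of_local` by name.
[cite: AizenmanDuminilCopinSidoraviciusCMP2015, proof of Thm. 3.1] -/
theorem stub_localisation :
    (∃ κ C : ℝ, 0 < κ ∧ ∀ x : Site 3, x ≠ 0 → ∃ N : ℕ, ∀ᶠ L : ℕ in atTop,
      1 - (sourcedDoubleCurrentLaw 3 L (criticalBeta 3) ({0} ∆ {x})
            ({(Pi.single 1 1 : Site 3)} ∆ {x + Pi.single 1 1})).real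
          (openConnVia (withinGraph ⊤ (↑(box 3 N) : Set (Site 3))) 0 (Pi.single 1 1)) ≤
        C * (‖x‖ : ℝ) ^ (-κ)) →
    ∃ κ C : ℝ, 0 < κ ∧ ∀ x : Site 3, x ≠ 0 →
      1 - (sourcedDoubleCurrentLawInf 3 (criticalBeta 3) ({0} ∆ {x})
            ({(Pi.single 1 1 : Site 3)} ∆ {x + Pi.single 1 1})).real (openConn 0 (Pi.single 1 1)) ≤
        C * (‖x‖ : ℝ) ^ (-κ) :=
  parAvoidancePowerLaw_of_local

end Summit.CriticalPhenomena.Ising3DConformalLimit.EnergyNotSigmaSquaredEnergyGapPowerLaw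

end
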